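import Summits.HubbardSuperconductivity.HubbardSuperconductivity.Theorems.WidthHaldaneTubeHelicityDescent

/-!
# The helicity criterion: a helicity floor and an entropy budget at `β = C·L` give the stiffness floor

Support file for crux `WidthUniformThermodynamics` (stmt-HubbardSuperconductivity-16312; routes
`WidthHaldane`, `SeamInduction`). The crux idea
`Cruxes/WidthUniformThermodynamics/Ideas/euclidean-helicity-descent.md` (2026-08-17 round) derives
conjunct (i) of `UniformThermo` (`d₀ ≤ ρ̃_{L,M}(U, δ)`, `Theorems/WidthHaldaneDefs`) from two
statements about the canonical sector partition function
`Z_β(θ) = re tr (P_{(N, S^z = 0)} e^{-β(H₀ + Tw_θ)})`, `F_β(θ) = -β⁻¹ log Z_β(θ)`, of the twisted tube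
at the mesoscopic inverse temperature `β = C·L` (its reduction `StiffnessOfHelicity`):

* a HELICITY FLOOR `c·(π/3)²·M/L ≤ F_{CL}(π/3) - F_{CL}(0)` (the card's ★ stub `HelicityFloorAt`), and
* an ENTROPY BUDGET `log (Z_{CL}(0) e^{CL·E(0, N)}) ≤ b·C·M` (the card's soft stub `EntropyBudgetAt`)

give `2c - 18b/π² ≤ ρ̃_{L,M}(U, δ)`, by the helicity descent
`[F_β(θ₀) - F_β(0)] - β⁻¹ log (Z_β(0) e^{βE(0)}) ≤ E(θ₀) - E(0)` landed in
`Theorems/WidthHaldaneTubeHelicityDescent.lean` (`helicity_descent`, registered sub-goal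
`helicityDescent`). This file PROVES the reduction, def-free and in the same written-out vocabulary
(`P_K = projMatrix` of the transported sector, `e^{-βH} = Matrix.gibbsWeight`), at the cruxes'
filling `N = tubeFilling L M δ` for every `δ ≥ -1` (so that the sector is non-empty):

* `tubeStiffness_ge_of_freeEnergy_floor` — for every `β > 0`: a floor `A ≤ F_β(π/3) - F_β(0)` and a
  budget `log (Z_β(0) e^{βE(0,N)}) ≤ B` give `2L(A - B/β)/((π/3)² M) ≤ ρ̃_{L,M}(U, δ)`;
* **`tubeStiffness_ge_of_helicity`** — at `β = C·L`: the two displayed hypotheses give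
  `2c - 18b/π² ≤ ρ̃_{L,M}(U, δ)`;
* `stiffnessOfHelicity` — the closed form (all binders universal), the registered sub-goal.

With this file and the descent, the card's in-Lean part is complete: a line built on it has exactly
its two ★ stubs (`HelicityFloorAt` width-uniformly = positive-temperature rigidity at `T = 1/(CL)`,
and the level-counting budget) left to supply; neither is touched here, and nothing here is progress
on the open core of the crux. References: E. L. Pollock, D. M. Ceperley, PRB 36 (1987) 8343
(helicity modulus from twisted partition functions); D. J. Scalapino, S. R. White, S. C. Zhang,
PRB 47 (1993) 7995, §II; M. E. Fisher, M. N. Barber, D. Jasnow, PRA 8 (1973) 1111 (helicity modulus).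
-/

noncomputable section

namespace Summit.HubbardSuperconductivity.HubbardSuperconductivity.Theorems.WidthHaldane

set_option linter.dupNamespace false -- summit = problem name (single-conjunct summit), D-0017

open scoped BigOperators Classical Matrix ComplexConjugate Matrix.Norms.L2Operator
open Matrix Literature.MathematicalPhysics.QuantumLattice

section HelicityCriterion

variable (L M : ℕ) [NeZero L] [NeZero M] (Λ : Type) [LinearOrder Λ] [Fintype Λ]
  (e : Λ ≃ ZMod L × ZMod M)

/-- **Free-energy floor + entropy budget ⇒ stiffness floor**, at every `β > 0`: if the twisted sector
free energy at the cruxes' filling `N = N_{L,M}(δ)` (`δ ≥ -1`) rises by at least `A` under the twist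
`π/3`, `A ≤ F_β(π/3) - F_β(0)`, and the entropy slack of the untwisted tube is at most `B`,
`log (Z_β(0) e^{βE(0,N)}) ≤ B`, then `2L(A - B/β)/((π/3)² M) ≤ ρ̃_{L,M}(U, δ)` — the helicity
descent read on `tubeStiffness`. [folklore] -/
theorem tubeStiffness_ge_of_freeEnergy_floor (U : ℝ) {δ : ℝ} (hδ : -1 ≤ δ) {β : ℝ} (hβ : 0 < β)
    {A B : ℝ}
    (hfloor : A ≤
      -Real.log ((projMatrix ((szSector (Λ := Λ) (tubeFilling L M δ) 0).map
          ((WithLp.linearEquiv 2 ℂ (Finset (Orb Λ) → ℂ)).symm :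
            (Finset (Orb Λ) → ℂ) →ₗ[ℂ] EuclideanSpace ℂ (Finset (Orb Λ)))) *
        gibbsWeight β (tubeH0 L M Λ e U + tubeTwist L M Λ e (Real.pi / 3))).trace).re / β -
      -Real.log ((projMatrix ((szSector (Λ := Λ) (tubeFilling L M δ) 0).map
          ((WithLp.linearEquiv 2 ℂ (Finset (Orb Λ) → ℂ)).symm :
            (Finset (Orb Λ) → ℂ) →ₗ[ℂ] EuclideanSpace ℂ (Finset (Orb Λ)))) *
        gibbsWeight β (tubeH0 L M Λ e U + tubeTwist L M Λ e 0)).trace).re / β)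
    (hbudget : Real.log (((projMatrix ((szSector (Λ := Λ) (tubeFilling L M δ) 0).map
          ((WithLp.linearEquiv 2 ℂ (Finset (Orb Λ) → ℂ)).symm :
            (Finset (Orb Λ) → ℂ) →ₗ[ℂ] EuclideanSpace ℂ (Finset (Orb Λ)))) *
        gibbsWeight β (tubeH0 L M Λ e U + tubeTwist L M Λ e 0)).trace).re *
          Real.exp (β * tubeEnergy L M Λ e U 0 (tubeFilling L M δ))) ≤ B) :
    2 * (L : ℝ) * (A - B / β) / ((Real.pi / 3) ^ 2 * (M : ℝ)) ≤ tubeStiffness L M Λ e U δ := by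
  -- the descent at `θ₀ = π/3` on the sector `(2n, 0)`, `2n = N_{L,M}(δ)` (definitionally)
  have hdesc :
      (-Real.log ((projMatrix ((szSector (Λ := Λ) (tubeFilling L M δ) 0).map
          ((WithLp.linearEquiv 2 ℂ (Finset (Orb Λ) → ℂ)).symm :
            (Finset (Orb Λ) → ℂ) →ₗ[ℂ] EuclideanSpace ℂ (Finset (Orb Λ)))) *
        gibbsWeight β (tubeH0 L M Λ e U + tubeTwist L M Λ e (Real.pi / 3))).trace).re / β -
      -Real.log ((projMatrix ((szSector (Λ := Λ) (tubeFilling L M δ) 0).map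
          ((WithLp.linearEquiv 2 ℂ (Finset (Orb Λ) → ℂ)).symm :
            (Finset (Orb Λ) → ℂ) →ₗ[ℂ] EuclideanSpace ℂ (Finset (Orb Λ)))) *
        gibbsWeight β (tubeH0 L M Λ e U + tubeTwist L M Λ e 0)).trace).re / β) -
      Real.log (((projMatrix ((szSector (Λ := Λ) (tubeFilling L M δ) 0).map
          ((WithLp.linearEquiv 2 ℂ (Finset (Orb Λ) → ℂ)).symm :
            (Finset (Orb Λ) → ℂ) →ₗ[ℂ] EuclideanSpace ℂ (Finset (Orb Λ)))) *
        gibbsWeight β (tubeH0 L M Λ e U + tubeTwist L M Λ e 0)).trace).re *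
          Real.exp (β * tubeEnergy L M Λ e U 0 (tubeFilling L M δ))) / β ≤
      tubeEnergy L M Λ e U (Real.pi / 3) (tubeFilling L M δ) -
        tubeEnergy L M Λ e U 0 (tubeFilling L M δ) :=
    helicity_descent L M Λ e U (Real.pi / 3) hβ (half_tubeFilling_le L M hδ)
  have hB : Real.log (((projMatrix ((szSector (Λ := Λ) (tubeFilling L M δ) 0).map
          ((WithLp.linearEquiv 2 ℂ (Finset (Orb Λ) → ℂ)).symm :
            (Finset (Orb Λ) → ℂ) →ₗ[ℂ] EuclideanSpace ℂ (Finset (Orb Λ)))) *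
        gibbsWeight β (tubeH0 L M Λ e U + tubeTwist L M Λ e 0)).trace).re *
          Real.exp (β * tubeEnergy L M Λ e U 0 (tubeFilling L M δ))) / β ≤ B / β :=
    div_le_div_of_nonneg_right hbudget hβ.le
  have hΔ : A - B / β ≤ tubeEnergy L M Λ e U (Real.pi / 3) (tubeFilling L M δ) -
      tubeEnergy L M Λ e U 0 (tubeFilling L M δ) := by linarith
  have hL0 : (0 : ℝ) < L := Nat.cast_pos.2 (NeZero.pos L)
  have hM0 : (0 : ℝ) < M := Nat.cast_pos.2 (NeZero.pos M)
  rw [tubeStiffness_eq]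
  exact div_le_div_of_nonneg_right (mul_le_mul_of_nonneg_left hΔ (by positivity)) (by positivity)

/-- **THE HELICITY CRITERION** (card `euclidean-helicity-descent`, `StiffnessOfHelicity`): at the
mesoscopic inverse temperature `β = C·L`, `C > 0`, a HELICITY FLOOR
`c·(π/3)²·M/L ≤ F_{CL}(π/3) - F_{CL}(0)` together with an ENTROPY BUDGET
`log (Z_{CL}(0) e^{CL·E(0,N)}) ≤ b·C·M` at the cruxes' filling `N = N_{L,M}(δ)`, `δ ≥ -1`, gives the
stiffness floor `2c - 18b/π² ≤ ρ̃_{L,M}(U, δ)`. Here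
`Z_β(θ) = re tr (P_{(N, S^z=0)} e^{-β(H₀ + Tw_θ)})` and `F_β = -β⁻¹ log Z_β`, written out. [folklore] -/
theorem tubeStiffness_ge_of_helicity (U : ℝ) {δ : ℝ} (hδ : -1 ≤ δ) {C : ℝ} (hC : 0 < C) {c b : ℝ}
    (hfloor : c * (Real.pi / 3) ^ 2 * (M : ℝ) / (L : ℝ) ≤
      -Real.log ((projMatrix ((szSector (Λ := Λ) (tubeFilling L M δ) 0).map
          ((WithLp.linearEquiv 2 ℂ (Finset (Orb Λ) → ℂ)).symm :
            (Finset (Orb Λ) → ℂ) →ₗ[ℂ] EuclideanSpace ℂ (Finset (Orb Λ)))) *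
        gibbsWeight (C * L) (tubeH0 L M Λ e U + tubeTwist L M Λ e (Real.pi / 3))).trace).re / (C * L) -
      -Real.log ((projMatrix ((szSector (Λ := Λ) (tubeFilling L M δ) 0).map
          ((WithLp.linearEquiv 2 ℂ (Finset (Orb Λ) → ℂ)).symm :
            (Finset (Orb Λ) → ℂ) →ₗ[ℂ] EuclideanSpace ℂ (Finset (Orb Λ)))) *
        gibbsWeight (C * L) (tubeH0 L M Λ e U + tubeTwist L M Λ e 0)).trace).re / (C * L))
    (hbudget : Real.log (((projMatrix ((szSector (Λ := Λ) (tubeFilling L M δ) 0).map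
          ((WithLp.linearEquiv 2 ℂ (Finset (Orb Λ) → ℂ)).symm :
            (Finset (Orb Λ) → ℂ) →ₗ[ℂ] EuclideanSpace ℂ (Finset (Orb Λ)))) *
        gibbsWeight (C * L) (tubeH0 L M Λ e U + tubeTwist L M Λ e 0)).trace).re *
          Real.exp (C * L * tubeEnergy L M Λ e U 0 (tubeFilling L M δ))) ≤ b * C * M) :
    2 * c - 18 * b / Real.pi ^ 2 ≤ tubeStiffness L M Λ e U δ := by
  have hL0 : (0 : ℝ) < L := Nat.cast_pos.2 (NeZero.pos L)
  have hM0 : (0 : ℝ) < M := Nat.cast_pos.2 (NeZero.pos M)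
  have hβ : 0 < C * L := mul_pos hC hL0
  have h := tubeStiffness_ge_of_freeEnergy_floor L M Λ e U hδ hβ hfloor hbudget
  have hbud : b * C * (M : ℝ) / (C * L) = b * M / L := by
    field_simp
  have key : 2 * (L : ℝ) * (c * (Real.pi / 3) ^ 2 * (M : ℝ) / (L : ℝ) - b * C * (M : ℝ) / (C * L)) /
      ((Real.pi / 3) ^ 2 * (M : ℝ)) = 2 * c - 18 * b / Real.pi ^ 2 := by
    rw [hbud]
    field_simp
    ring
  rw [key] at h
  exact h

end HelicityCriterion

/-- **THE HELICITY CRITERION, closed form** (the registered sub-goal `stiffnessOfHelicity` of crux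
stmt-HubbardSuperconductivity-16312; all binders universally quantified): for every labelled tube,
every `U`, every `δ ≥ -1`, every `C > 0` and all `c, b`: the helicity floor
`c(π/3)²M/L ≤ F_{CL}(π/3) - F_{CL}(0)` and the entropy budget `log (Z_{CL}(0) e^{CL·E(0,N)}) ≤ bCM`
at `N = N_{L,M}(δ)` give `2c - 18b/π² ≤ ρ̃_{L,M}(U, δ)`. [folklore] -/
theorem stiffnessOfHelicity : ∀ (L M : ℕ) [NeZero L] [NeZero M] (Λ : Type) [LinearOrder Λ] [Fintype Λ] (e : Λ ≃ ZMod L × ZMod M) (U δ C c b : ℝ), -1 ≤ δ → 0 < C → c * (Real.pi / 3) ^ 2 * (M : ℝ) / (L : ℝ) ≤ -Real.log ((projMatrix ((szSector (Λ := Λ) (tubeFilling L M δ) 0).map ((WithLp.linearEquiv 2 ℂ (Finset (Orb Λ) → ℂ)).symm : (Finset (Orb Λ) → ℂ) →ₗ[ℂ] EuclideanSpace ℂ (Finset (Orb Λ)))) * gibbsWeight (C * L) (tubeH0 L M Λ e U + tubeTwist L M Λ e (Real.pi / 3))).trace).re / (C * L) - -Real.log ((projMatrix ((szSector (Λ :=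 Λ) (tubeFilling L M δ) 0).map ((WithLp.linearEquiv 2 ℂ (Finset (Orb Λ) → ℂ)).symm : (Finset (Orb Λ) → ℂ) →ₗ[ℂ] EuclideanSpace ℂ (Finset (Orb Λ)))) * gibbsWeight (C * L) (tubeH0 L M Λ e U + tubeTwist L M Λ e 0)).trace).re / (C * L) → Real.log (((projMatrix ((szSector (Λ := Λ) (tubeFilling L M δ) 0).map ((WithLp.linearEquiv 2 ℂ (Finset (Orb Λ) → ℂ)).symm : (Finset (Orb Λ) → ℂ) →ₗ[ℂ] EuclideanSpace ℂ (Finset (Orb Λ)))) * gibbsWeight (C * L) (tubeH0 L M Λ e U + tubeTwist L M Λ e 0)).trace).re * Real.exp (C * L * tubeEnergy L M Λ e U 0 (tubeFilling L M δ))) ≤ b * C * M → 2 * c - 18 * b / Real.pi ^ 2 ≤ tubeStiffness L M Λ e U δ :=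
  fun L M _ _ Λ _ _ e U _δ _C _c _b hδ hC hfloor hbudget =>
    tubeStiffness_ge_of_helicity L M Λ e U hδ hC hfloor hbudget

end Summit.HubbardSuperconductivity.HubbardSuperconductivity.Theorems.WidthHaldane

end
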